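import Summits.AtomisticToContinuum.Crystallization.Theorems.ChartedZeroExcessLayeredLatticeLiouvilleVD

/-!
# Zero-excess layered lattice Liouville — part VE (lens-2 g57, node «MixedSup» 2/2): the sup bound on INDEX CUBES from energies of in-plane iterates.

`sup_sq_le_mixed` (index cube `B = idxBallF x₀ n` charted by `cubePt`, `N = 2⌊n⌋₊`, `#B = (N+1)³` by `card_idxBallF_eq`): for every lattice field `ψ`
and `X ∈ B`, `(N+1)³ ‖ψ X‖² ≤ 8 [ Σ_B ‖ψ‖² + 3(N+1)N·E(ψ) + ((N+1)N)²(2E(D₂ψ) + E(D₁ψ)) + ((N+1)N)³ E(D₁D₂ψ) ]`, `E = idxEnergy · (idxBall x₀ n)`,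
`Dᵢ = latDiff idxAxisᵢ` the IN-PLANE unit differences: part VD's `cubeSupBound` through the chart, with every cross-layer difference PEELED along `e₃`
into an energy (`boxSum_latDiff_le_idxEnergy`), so all right-hand terms are energies of purely in-plane iterates — the quantities part VC controls for
truncated-harmonic fields.  Bricks of (LD) `LinearExcessDecayZ`; nothing of the column is re-typed, nothing here is an item.
-/

noncomputable section

open scoped BigOperators InnerProductSpace RealInnerProductSpace
open MeasureTheory Set Metric Filter Topology
open Summit.AtomisticToContinuum.Crystallization.Theorems.ChartedPlanarOrderRigidityDoor (E3 IsNash atomsIn)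
open Summit.AtomisticToContinuum.Crystallization.Theorems.ChartedPlanarOrderDensityDichotomy (μS IsSep nK nK_nonneg)
open Summit.AtomisticToContinuum.Crystallization.Theorems.ChartedPlanarOrderDoorLayered (Layered layeredHom_eq_layered)

namespace Summit.AtomisticToContinuum.Crystallization.Theorems.ChartedZeroExcessLayeredLatticeLiouville

section MixedSupChart

/-! ### VE.1  The chart of the index cube -/

/-- corner chart of the index cube of integer radius `R` about `x₀`: `(i, j, k) ↦ x₀ + (i − R)e₁ + (j − R)e₂ + (k − R)e₃`. [this file, g57] -/
def cubePt (x₀ : Cell 2 × ℤ) (R : ℕ) (i j k : ℕ) : Cell 2 × ℤ :=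
  x₀ + (((i : ℤ) - R) • idxAxis₁ + ((j : ℤ) - R) • idxAxis₂ + ((k : ℤ) - R) • idxAxis₃)

/-- Auxiliary step (`cubePt sub fst zero`). [formal bookkeeping] -/
theorem cubePt_sub_fst_zero (x₀ : Cell 2 × ℤ) (R i j k : ℕ) : (cubePt x₀ R i j k - x₀).1 0 = (i : ℤ) - R := by
  simp [cubePt, idxAxis₁, idxAxis₂, idxAxis₃]

/-- Auxiliary step (`cubePt sub fst one`). [formal bookkeeping] -/
theorem cubePt_sub_fst_one (x₀ : Cell 2 × ℤ) (R i j k : ℕ) : (cubePt x₀ R i j k - x₀).1 1 = (j : ℤ) - R := by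
  simp [cubePt, idxAxis₁, idxAxis₂, idxAxis₃]

/-- Auxiliary step (`cubePt sub snd`). [formal bookkeeping] -/
theorem cubePt_sub_snd (x₀ : Cell 2 × ℤ) (R i j k : ℕ) : (cubePt x₀ R i j k - x₀).2 = (k : ℤ) - R := by
  simp [cubePt, idxAxis₁, idxAxis₂, idxAxis₃]

/-- Auxiliary step (`cubePt succ₁`). [formal bookkeeping] -/
theorem cubePt_succ₁ (x₀ : Cell 2 × ℤ) (R i j k : ℕ) : cubePt x₀ R (i + 1) j k = cubePt x₀ R i j k + idxAxis₁ := by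
  simp only [cubePt, Nat.cast_add, Nat.cast_one]
  rw [show ((i : ℤ) + 1 - R) = ((i : ℤ) - R) + 1 by ring, add_zsmul, one_zsmul]
  abel

/-- Auxiliary step (`cubePt succ₂`). [formal bookkeeping] -/
theorem cubePt_succ₂ (x₀ : Cell 2 × ℤ) (R i j k : ℕ) : cubePt x₀ R i (j + 1) k = cubePt x₀ R i j k + idxAxis₂ := by
  simp only [cubePt, Nat.cast_add, Nat.cast_one]
  rw [show ((j : ℤ) + 1 - R) = ((j : ℤ) - R) + 1 by ring, add_zsmul, one_zsmul]
  abel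

/-- Auxiliary step (`cubePt succ₃`). [formal bookkeeping] -/
theorem cubePt_succ₃ (x₀ : Cell 2 × ℤ) (R i j k : ℕ) : cubePt x₀ R i j (k + 1) = cubePt x₀ R i j k + idxAxis₃ := by
  simp only [cubePt, Nat.cast_add, Nat.cast_one]
  rw [show ((k : ℤ) + 1 - R) = ((k : ℤ) - R) + 1 by ring, add_zsmul, one_zsmul]
  abel

/-- the chart maps the box `[0, 2R]³` into the cube. [this file, g57] -/
theorem cubePt_mem (x₀ : Cell 2 × ℤ) {n : ℝ} (hn : 0 ≤ n) {i j k : ℕ} (hi : i ≤ 2 * ⌊n⌋₊) (hj : j ≤ 2 * ⌊n⌋₊)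
    (hk : k ≤ 2 * ⌊n⌋₊) : cubePt x₀ ⌊n⌋₊ i j k ∈ idxBallF x₀ n := by
  rw [mem_idxBallF_iff_idxNorm]
  have h1 : idxNorm (cubePt x₀ ⌊n⌋₊ i j k - x₀) ≤ ⌊n⌋₊ := by
    unfold idxNorm
    rw [cubePt_sub_fst_zero, cubePt_sub_fst_one, cubePt_sub_snd]
    refine max_le (max_le ?_ ?_) ?_ <;> omega
  calc (idxNorm (cubePt x₀ ⌊n⌋₊ i j k - x₀) : ℝ) ≤ ⌊n⌋₊ := by exact_mod_cast h1
    _ ≤ n := Nat.floor_le hn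

/-- the chart is onto the cube. [this file, g57] -/
theorem exists_cubePt_eq {x₀ X : Cell 2 × ℤ} {n : ℝ} (hX : X ∈ idxBallF x₀ n) :
    ∃ i j k : ℕ, i ≤ 2 * ⌊n⌋₊ ∧ j ≤ 2 * ⌊n⌋₊ ∧ k ≤ 2 * ⌊n⌋₊ ∧ X = cubePt x₀ ⌊n⌋₊ i j k := by
  have hv := idxNorm_le_floor_of_mem hX
  have h0 := (natAbs_fst_le_idxNorm (X - x₀) 0).trans hv
  have h1 := (natAbs_fst_le_idxNorm (X - x₀) 1).trans hv
  have h2 := (natAbs_snd_le_idxNorm (X - x₀)).trans hv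
  refine ⟨((X - x₀).1 0 + ⌊n⌋₊).toNat, ((X - x₀).1 1 + ⌊n⌋₊).toNat, ((X - x₀).2 + ⌊n⌋₊).toNat, by omega, by omega, by omega, ?_⟩
  have e0 : ((((X - x₀).1 0 + ⌊n⌋₊).toNat : ℕ) : ℤ) - (⌊n⌋₊ : ℕ) = (X - x₀).1 0 := by omega
  have e1 : ((((X - x₀).1 1 + ⌊n⌋₊).toNat : ℕ) : ℤ) - (⌊n⌋₊ : ℕ) = (X - x₀).1 1 := by omega
  have e2 : ((((X - x₀).2 + ⌊n⌋₊).toNat : ℕ) : ℤ) - (⌊n⌋₊ : ℕ) = (X - x₀).2 := by omega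
  rw [cubePt, e0, e1, e2, ← idx_decomp (X - x₀), add_sub_cancel]

/-- the chart is injective (coordinates). [formal bookkeeping] -/
theorem cubePt_inj {x₀ : Cell 2 × ℤ} {R i j k i' j' k' : ℕ} (h : cubePt x₀ R i j k = cubePt x₀ R i' j' k') :
    i = i' ∧ j = j' ∧ k = k' := by
  have h0 := congrArg (fun P : Cell 2 × ℤ => (P - x₀).1 0) h
  have h1 := congrArg (fun P : Cell 2 × ℤ => (P - x₀).1 1) h
  have h2 := congrArg (fun P : Cell 2 × ℤ => (P - x₀).2) h
  simp only [cubePt_sub_fst_zero, cubePt_sub_fst_one, cubePt_sub_snd] at h0 h1 h2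
  omega

/-- the cube has exactly `(2R+1)³` sites. [this file, g57] -/
theorem card_idxBallF_eq (x₀ : Cell 2 × ℤ) {n : ℝ} (hn : 0 ≤ n) : (idxBallF x₀ n).card = (2 * ⌊n⌋₊ + 1) ^ 3 := by
  refine le_antisymm ?_ (le_card_idxBallF x₀ hn)
  set B3 : Finset ((ℕ × ℕ) × ℕ) := (Finset.range (2 * ⌊n⌋₊ + 1) ×ˢ Finset.range (2 * ⌊n⌋₊ + 1)) ×ˢ Finset.range (2 * ⌊n⌋₊ + 1)
  have hsub : idxBallF x₀ n ⊆ B3.image (fun x => cubePt x₀ ⌊n⌋₊ x.1.1 x.1.2 x.2) := by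
    intro X hX
    obtain ⟨i, j, k, hi, hj, hk, rfl⟩ := exists_cubePt_eq hX
    refine Finset.mem_image.mpr ⟨((i, j), k), ?_, rfl⟩
    simp only [B3, Finset.mem_product, Finset.mem_range]
    omega
  calc (idxBallF x₀ n).card ≤ (B3.image (fun x => cubePt x₀ ⌊n⌋₊ x.1.1 x.1.2 x.2)).card := Finset.card_le_card hsub
    _ ≤ B3.card := Finset.card_image_le
    _ = (2 * ⌊n⌋₊ + 1) ^ 3 := by simp only [B3, Finset.card_product, Finset.card_range]; ring

/-! ### VE.2  Box differences are lattice differences; box sums are dominated by lattice sums -/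

/-- Auxiliary step (`fd₁ chart`). [formal bookkeeping] -/
theorem fd₁_chart (ψ : Cell 2 → ℤ → E3) (x₀ : Cell 2 × ℤ) (R : ℕ) :
    fd₁ (fun i j k => ψ (cubePt x₀ R i j k).1 (cubePt x₀ R i j k).2) =
      fun i j k => latDiff idxAxis₁ ψ (cubePt x₀ R i j k).1 (cubePt x₀ R i j k).2 := by
  funext i j k
  simp only [fd₁, latDiff_apply, cubePt_succ₁]

/-- Auxiliary step (`fd₂ chart`). [formal bookkeeping] -/
theorem fd₂_chart (ψ : Cell 2 → ℤ → E3) (x₀ : Cell 2 × ℤ) (R : ℕ) :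
    fd₂ (fun i j k => ψ (cubePt x₀ R i j k).1 (cubePt x₀ R i j k).2) =
      fun i j k => latDiff idxAxis₂ ψ (cubePt x₀ R i j k).1 (cubePt x₀ R i j k).2 := by
  funext i j k
  simp only [fd₂, latDiff_apply, cubePt_succ₂]

/-- Auxiliary step (`fd₃ chart`). [formal bookkeeping] -/
theorem fd₃_chart (ψ : Cell 2 → ℤ → E3) (x₀ : Cell 2 × ℤ) (R : ℕ) :
    fd₃ (fun i j k => ψ (cubePt x₀ R i j k).1 (cubePt x₀ R i j k).2) =
      fun i j k => latDiff idxAxis₃ ψ (cubePt x₀ R i j k).1 (cubePt x₀ R i j k).2 := by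
  funext i j k
  simp only [fd₃, latDiff_apply, cubePt_succ₃]

/-- nested box sums as a sum over the product index set. [formal bookkeeping] -/
theorem boxSum_eq_sum_product (a b c : Finset ℕ) (F : ℕ → ℕ → ℕ → ℝ) :
    ∑ j ∈ b, ∑ i ∈ a, ∑ k ∈ c, F i j k = ∑ x ∈ (b ×ˢ a) ×ˢ c, F x.1.2 x.1.1 x.2 := by
  rw [Finset.sum_product, Finset.sum_product]

/-- a box sum of a non-negative lattice function through the chart is at most the sum over the cube. [this file, g57] -/
theorem boxSum_le_sum (x₀ : Cell 2 × ℤ) {n : ℝ} (hn : 0 ≤ n) (g : Cell 2 × ℤ → ℝ) (hg : ∀ Y, 0 ≤ g Y) {a b c : Finset ℕ}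
    (ha : a ⊆ Finset.range (2 * ⌊n⌋₊ + 1)) (hb : b ⊆ Finset.range (2 * ⌊n⌋₊ + 1)) (hc : c ⊆ Finset.range (2 * ⌊n⌋₊ + 1)) :
    ∑ j ∈ b, ∑ i ∈ a, ∑ k ∈ c, g (cubePt x₀ ⌊n⌋₊ i j k) ≤ ∑ Y ∈ idxBallF x₀ n, g Y := by
  rw [boxSum_eq_sum_product]
  have hinj : Set.InjOn (fun x : (ℕ × ℕ) × ℕ => cubePt x₀ ⌊n⌋₊ x.1.2 x.1.1 x.2) ↑((b ×ˢ a) ×ˢ c) := by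
    intro x _ y _ hxy
    obtain ⟨h1, h2, h3⟩ := cubePt_inj hxy
    exact Prod.ext (Prod.ext h2 h1) h3
  rw [← Finset.sum_image hinj]
  refine Finset.sum_le_sum_of_subset_of_nonneg (fun Y hY => ?_) fun Y _ _ => hg Y
  obtain ⟨x, hx, rfl⟩ := Finset.mem_image.mp hY
  simp only [Finset.mem_product] at hx
  have h1 := Finset.mem_range.mp (hb hx.1.1)
  have h2 := Finset.mem_range.mp (ha hx.1.2)
  have h3 := Finset.mem_range.mp (hc hx.2)
  exact cubePt_mem x₀ hn (by omega) (by omega) (by omega)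

/-- a box sum of squared UNIT differences `‖D_e Ψ‖²` through the chart, over a box on which the step stays in the cube, is at most
`dispSqOn (cube) Ψ e ≤ idxEnergy Ψ (cube)`. [this file, g57] -/
theorem boxSum_latDiff_le_idxEnergy (x₀ : Cell 2 × ℤ) {n : ℝ} (hn : 0 ≤ n) (Ψ : Cell 2 → ℤ → E3) {e : Cell 2 × ℤ}
    (he : ∀ U : Cell 2 × ℤ, dist U (U + e) ≤ 1) {a b c : Finset ℕ}
    (ha : a ⊆ Finset.range (2 * ⌊n⌋₊ + 1)) (hb : b ⊆ Finset.range (2 * ⌊n⌋₊ + 1)) (hc : c ⊆ Finset.range (2 * ⌊n⌋₊ + 1))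
    (hstep : ∀ i ∈ a, ∀ j ∈ b, ∀ k ∈ c, cubePt x₀ ⌊n⌋₊ i j k + e ∈ idxBallF x₀ n) :
    ∑ j ∈ b, ∑ i ∈ a, ∑ k ∈ c, ‖latDiff e Ψ (cubePt x₀ ⌊n⌋₊ i j k).1 (cubePt x₀ ⌊n⌋₊ i j k).2‖ ^ 2 ≤
      idxEnergy Ψ (idxBall x₀ n) := by
  have hdom : ∑ j ∈ b, ∑ i ∈ a, ∑ k ∈ c, ‖latDiff e Ψ (cubePt x₀ ⌊n⌋₊ i j k).1 (cubePt x₀ ⌊n⌋₊ i j k).2‖ ^ 2 ≤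
      ∑ Y ∈ idxBallF x₀ n, (if Y + e ∈ idxBallF x₀ n then dispSqFam Ψ e Y else 0) := by
    have heq : ∑ j ∈ b, ∑ i ∈ a, ∑ k ∈ c, ‖latDiff e Ψ (cubePt x₀ ⌊n⌋₊ i j k).1 (cubePt x₀ ⌊n⌋₊ i j k).2‖ ^ 2 =
        ∑ j ∈ b, ∑ i ∈ a, ∑ k ∈ c,
          (if cubePt x₀ ⌊n⌋₊ i j k + e ∈ idxBallF x₀ n then dispSqFam Ψ e (cubePt x₀ ⌊n⌋₊ i j k) else 0) := by
      refine Finset.sum_congr rfl fun j hj => Finset.sum_congr rfl fun i hi => Finset.sum_congr rfl fun k hk => ?_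
      rw [if_pos (hstep i hi j hj k hk), norm_latDiff_sq]
    rw [heq]
    refine boxSum_le_sum x₀ hn (fun Y => if Y + e ∈ idxBallF x₀ n then dispSqFam Ψ e Y else 0) (fun Y => ?_) ha hb hc
    split_ifs
    · exact sq_nonneg _
    · exact le_rfl
  have h2 : dispSqOn (idxBallF x₀ n) Ψ e ≤ idxEnergy Ψ (idxBall x₀ n) := by
    rw [← coe_idxBallF]
    exact dispSqOn_le_idxEnergy _ Ψ he
  exact hdom.trans h2

/-! ### VE.3  ★★ The sup bound on index cubes from tangential iterates -/

/-- Auxiliary step (`range subset range succ`). [formal bookkeeping] -/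
theorem range_subset_range_succ (N : ℕ) : Finset.range N ⊆ Finset.range (N + 1) :=
  Finset.range_mono (Nat.le_succ N)

/-- ★★ **SUP BOUND FROM MIXED DIFFERENCES** on the index cube `B = idxBallF x₀ n` (`n ≥ 0`, `R = ⌊n⌋₊`, `N = 2R`, `#B = (N+1)³`): for every
lattice field `ψ` and every `X ∈ B`,
`(N+1)³ ‖ψ X‖² ≤ 8 [ Σ_{Y ∈ B} ‖ψ Y‖² + 3 (N+1)N · E(ψ) + ((N+1)N)² (2 E(D₂ψ) + E(D₁ψ)) + ((N+1)N)³ E(D₁D₂ψ) ]`, `E = idxEnergy · (idxBall x₀ n)`,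
`D₁, D₂` the IN-PLANE unit differences (`latDiff idxAxis₁`, `latDiff idxAxis₂`).  Every cross-layer difference has been PEELED into an energy, so all
right-hand terms are energies of tangential iterates — for a truncated-harmonic field they are paid by part VC.  Scale count: with
`Σ‖ψ‖² ≲ n² E` (Poincaré after removing the mean) every term is `≲ n^{2|S|} E(D^S ψ)`, i.e. the bound is scale-invariant. [this file, g57] -/
theorem sup_sq_le_mixed (x₀ : Cell 2 × ℤ) {n : ℝ} (hn : 0 ≤ n) (ψ : Cell 2 → ℤ → E3) {X : Cell 2 × ℤ} (hX : X ∈ idxBallF x₀ n) :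
    ((((2 * ⌊n⌋₊ : ℕ) : ℝ) + 1)) ^ 3 * ‖ψ X.1 X.2‖ ^ 2 ≤
      8 * (∑ Y ∈ idxBallF x₀ n, ‖ψ Y.1 Y.2‖ ^ 2
        + ((((2 * ⌊n⌋₊ : ℕ) : ℝ) + 1) * ((2 * ⌊n⌋₊ : ℕ) : ℝ)) * (3 * idxEnergy ψ (idxBall x₀ n))
        + ((((2 * ⌊n⌋₊ : ℕ) : ℝ) + 1) * ((2 * ⌊n⌋₊ : ℕ) : ℝ)) ^ 2 *
            (idxEnergy (latDiff idxAxis₂ ψ) (idxBall x₀ n) + idxEnergy (latDiff idxAxis₁ ψ) (idxBall x₀ n)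
              + idxEnergy (latDiff idxAxis₂ ψ) (idxBall x₀ n))
        + ((((2 * ⌊n⌋₊ : ℕ) : ℝ) + 1) * ((2 * ⌊n⌋₊ : ℕ) : ℝ)) ^ 3 *
            idxEnergy (latDiff idxAxis₁ (latDiff idxAxis₂ ψ)) (idxBall x₀ n)) := by
  obtain ⟨i, j, k, hi, hj, hk, rfl⟩ := exists_cubePt_eq hX
  set R : ℕ := ⌊n⌋₊ with hR
  set N : ℕ := 2 * R with hNdef
  have hM : (0 : ℝ) ≤ ((N : ℝ) + 1) * N := by positivity
  -- the abstract cube bound for the charted field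
  have hcube := cubeSupBound (fun i j k => ψ (cubePt x₀ R i j k).1 (cubePt x₀ R i j k).2) hi hj hk
  -- rewrite the box differences as lattice differences
  have c3 : fd₃ (fun i j k => ψ (cubePt x₀ R i j k).1 (cubePt x₀ R i j k).2) =
      fun i j k => latDiff idxAxis₃ ψ (cubePt x₀ R i j k).1 (cubePt x₀ R i j k).2 := fd₃_chart ψ x₀ R
  have c1 := fd₁_chart ψ x₀ R
  have c2 := fd₂_chart ψ x₀ R
  have c12 : fd₁ (fd₂ (fun i j k => ψ (cubePt x₀ R i j k).1 (cubePt x₀ R i j k).2)) =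
      fun i j k => latDiff idxAxis₁ (latDiff idxAxis₂ ψ) (cubePt x₀ R i j k).1 (cubePt x₀ R i j k).2 := by
    rw [c2, fd₁_chart]
  have c31 : fd₃ (fd₁ (fun i j k => ψ (cubePt x₀ R i j k).1 (cubePt x₀ R i j k).2)) =
      fun i j k => latDiff idxAxis₃ (latDiff idxAxis₁ ψ) (cubePt x₀ R i j k).1 (cubePt x₀ R i j k).2 := by
    rw [c1, fd₃_chart]
  have c32 : fd₃ (fd₂ (fun i j k => ψ (cubePt x₀ R i j k).1 (cubePt x₀ R i j k).2)) =
      fun i j k => latDiff idxAxis₃ (latDiff idxAxis₂ ψ) (cubePt x₀ R i j k).1 (cubePt x₀ R i j k).2 := by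
    rw [c2, fd₃_chart]
  have c312 : fd₃ (fd₁ (fd₂ (fun i j k => ψ (cubePt x₀ R i j k).1 (cubePt x₀ R i j k).2))) =
      fun i j k => latDiff idxAxis₃ (latDiff idxAxis₁ (latDiff idxAxis₂ ψ)) (cubePt x₀ R i j k).1 (cubePt x₀ R i j k).2 := by
    rw [c12, fd₃_chart]
  rw [c312, c31, c32, c12, c3, c1, c2] at hcube
  simp only at hcube
  -- the box sums are dominated by lattice quantities
  have hs := range_subset_range_succ N
  have hf : Finset.range (N + 1) ⊆ Finset.range (2 * ⌊n⌋₊ + 1) := subset_of_eq rfl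
  have hs' : Finset.range N ⊆ Finset.range (2 * ⌊n⌋₊ + 1) := hs.trans hf
  have step₁ : ∀ i ∈ Finset.range N, ∀ j ∈ Finset.range (N + 1), ∀ k ∈ Finset.range (N + 1),
      cubePt x₀ R i j k + idxAxis₁ ∈ idxBallF x₀ n := fun i hi j hj k hk => by
    rw [← cubePt_succ₁]
    exact cubePt_mem x₀ hn (by have := Finset.mem_range.mp hi; omega) (by have := Finset.mem_range.mp hj; omega)
      (by have := Finset.mem_range.mp hk; omega)
  have step₂ : ∀ i ∈ Finset.range (N + 1), ∀ j ∈ Finset.range N, ∀ k ∈ Finset.range (N + 1),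
      cubePt x₀ R i j k + idxAxis₂ ∈ idxBallF x₀ n := fun i hi j hj k hk => by
    rw [← cubePt_succ₂]
    exact cubePt_mem x₀ hn (by have := Finset.mem_range.mp hi; omega) (by have := Finset.mem_range.mp hj; omega)
      (by have := Finset.mem_range.mp hk; omega)
  have step₃ : ∀ (a b : Finset ℕ), a ⊆ Finset.range (N + 1) → b ⊆ Finset.range (N + 1) →
      ∀ i ∈ a, ∀ j ∈ b, ∀ k ∈ Finset.range N, cubePt x₀ R i j k + idxAxis₃ ∈ idxBallF x₀ n :=
    fun a b ha hb i hi j hj k hk => by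
    rw [← cubePt_succ₃]
    exact cubePt_mem x₀ hn (by have := Finset.mem_range.mp (ha hi); omega) (by have := Finset.mem_range.mp (hb hj); omega)
      (by have := Finset.mem_range.mp hk; omega)
  have E0 := idxEnergy_nonneg ψ (idxBall x₀ n)
  have b0 := boxSum_le_sum x₀ hn (fun Y => ‖ψ Y.1 Y.2‖ ^ 2) (fun Y => sq_nonneg _) hf hf hf
  have b1 := boxSum_latDiff_le_idxEnergy x₀ hn ψ dist_add_idxAxis₁_le hs' hf hf step₁
  have b2 := boxSum_latDiff_le_idxEnergy x₀ hn ψ dist_add_idxAxis₂_le hf hs' hf step₂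
  have b3 := boxSum_latDiff_le_idxEnergy x₀ hn ψ dist_add_idxAxis₃_le hf hf hs'
    (step₃ _ _ subset_rfl subset_rfl)
  have b12 := boxSum_latDiff_le_idxEnergy x₀ hn (latDiff idxAxis₂ ψ) dist_add_idxAxis₁_le hs' hs' hf
    (fun i hi j hj k hk => step₁ i hi j (hs hj) k hk)
  have b31 := boxSum_latDiff_le_idxEnergy x₀ hn (latDiff idxAxis₁ ψ) dist_add_idxAxis₃_le hs' hf hs'
    (step₃ _ _ hs subset_rfl)
  have b32 := boxSum_latDiff_le_idxEnergy x₀ hn (latDiff idxAxis₂ ψ) dist_add_idxAxis₃_le hf hs' hs'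
    (step₃ _ _ subset_rfl hs)
  have b312 := boxSum_latDiff_le_idxEnergy x₀ hn (latDiff idxAxis₁ (latDiff idxAxis₂ ψ)) dist_add_idxAxis₃_le hs' hs' hs'
    (step₃ _ _ hs hs)
  have hNcast : ((N : ℕ) : ℝ) = ((2 * ⌊n⌋₊ : ℕ) : ℝ) := by rw [hNdef, hR]
  rw [← hNcast]
  have hM2 : (0 : ℝ) ≤ (((N : ℝ) + 1) * N) ^ 2 := pow_nonneg hM 2
  have hM3 : (0 : ℝ) ≤ (((N : ℝ) + 1) * N) ^ 3 := pow_nonneg hM 3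
  nlinarith [mul_le_mul_of_nonneg_left (add_le_add (add_le_add b1 b2) b3) hM,
    mul_le_mul_of_nonneg_left (add_le_add (add_le_add b12 b31) b32) hM2, mul_le_mul_of_nonneg_left b312 hM3, b0, hcube]

end MixedSupChart

end Summit.AtomisticToContinuum.Crystallization.Theorems.ChartedZeroExcessLayeredLatticeLiouville
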